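import Summits.AtomisticToContinuum.Crystallization.Theorems.FrustratedLawDichotomyAperiodicGapRecordJunctionTab
import Summits.AtomisticToContinuum.Crystallization.Theorems.FrustratedLawDichotomyStrainedPatchGradStep
import HarnessLib

/-!
# FrustratedLawDichotomy · crux `AperiodicFrustratedLawGap` (stmt-AtomisticToContinuum-27623) — RECORD JUNCTION, STAGE-CERTIFICATE FORM (R1⁗ in table/LP currency)
# (decomp-a2c, prover hand 2, generation 34; structural share, sequel of `…AperiodicGapRecordJunctionTab`)

`…RecordJunctionTab` (lens-5 g75, critic row 1256; R1⁗) reads the T-leaf `[CORE-FAR]` from the per-row host tables with an abstract START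
`HostTopTab … (P 0)` and abstract per-row STEPS `HostStepTab … (addCol X (P i)) (P (i+1))`.  lens-5 g76's node «GradStep» (`…StrainedPatchGradStep`,
critic row 1267: VERIFIED BY BYTES, «the certificate FORMAT OF RECORD» for the host-step column, GRAD-76 / GRAD-77 in the census order) CERTIFIES both in the
currency the census LPs actually produce: the START by BOX EVALUATION (`DiffEvalTab … (boxTab τ) (P 0)`, `hostTopTab_of_diffEvalTab_box`) and every stage by a
STAGE CERTIFICATE `StageCert 𝓘 τ σ₁ bondD3 T r hessBlk0 force0 Pm (addCol X (P i)) (P (i+1))` = first-difference tables + pair tables on the GLOBAL row polytope +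
the paired evaluation (`hostStepTab_of_stageCert`, pairing identity on near-centrosymmetric shells), under an admissible pairing `PairAdm r Pm`; its record is
`coreOff_of_envelope_tailCert_pairTabs` (and the one-stage shape `…_oneStage` the census instruments first).

This DEF-FREE module threads that record to the crux BY NAME, exactly as `…RecordJunctionTab` threads R1⁗ (same E-consumer of record, critic rows 1228/1238:
`homFloor_625_of_entryTrees6RBKP_HT4UQDCRX`):
* §1 `strainedPatchRec_of_homFloor_625_of_envelope_tailCert_pairTabs` (`n` certified stages) and `…_oneStage`;
* §2 ★★★ the crux BY NAME `aperiodicFrustratedLawGap_of_entryTreesU_of_envelope_tailCert_pairTabs` (+ periodic sibling 27624);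
* §3 the ONE-STAGE junction `aperiodicFrustratedLawGap_of_entryTreesU_of_envelope_tailCert_oneStage` (START by box evaluation, ONE global LP stage, terminal
  certificate — the GRAD-76/77 shape) (+ periodic sibling);
* §4 sanity at the cell width of record `τ = 1/100` (side conditions `1/50 < s₀`, `r ≤ 349/50`).

T-SIDE BINDER CENSUS after this file (every binder family-level, per-host, per-host-row or a finite table inequality; none cluster-quantified):
FamilyCover 𝓘 (24/5) (1/100) (1/8) τ · HostSep 𝓘 s₀ · HostFarTab 𝓘 τ r Xh · TailCert 𝓘 τ Xe · Xh + Xe ≤ X · PairAdm r Pm · DiffEvalTab … (boxTab τ) (P 0) [START, box] ·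
StageCert-table `addCol X (P i) ↦ P (i+1)` [STEP, LP tables] · SlackCert at `κ = 0` on `addCol X (P n)` [TERMINAL LP] (+ 0 ≤ τ, 2τ < s₀, r + 2τ ≤ 7).
One-line compositions of tree theorems; 0 sorry; no definitions; standard axioms.  `--supports stmt-AtomisticToContinuum-27623`.  [folklore instantiation]
-/

noncomputable section

namespace Summit.AtomisticToContinuum.Crystallization.Theorems.FrustratedLawDichotomyAperiodicGapRecordJunctionStage

open Summit.AtomisticToContinuum.Crystallization.Theorems.ChargedEnergyGapNegative (eStar E3)
open Summit.AtomisticToContinuum.Crystallization.Theorems.FrustratedLawDichotomyRangeCut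
open Summit.AtomisticToContinuum.Crystallization.Theorems.FrustratedLawDichotomySchurCut
open Summit.AtomisticToContinuum.Crystallization.Theorems.FrustratedLawDichotomyMotifLemmas (GoodAtScale)
open Summit.AtomisticToContinuum.Crystallization.Theorems.FrustratedLawDichotomyExemptLocOpt (LocOptFails)
open Summit.AtomisticToContinuum.Crystallization.Theorems.FrustratedLawDichotomyExemptSplit (SchurElasticPricingX)
open Summit.AtomisticToContinuum.Crystallization.Theorems.FrustratedLawDichotomyExemptAbsorptionRecord
open Summit.AtomisticToContinuum.Crystallization.Theorems.FrustratedLawDichotomyCollarCensus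
open Summit.AtomisticToContinuum.Crystallization.Theorems.FrustratedLawDichotomyCollarCensusKappa
open Summit.AtomisticToContinuum.Crystallization.Theorems.FrustratedLawDichotomyStrainedPatchHomSplit
open Summit.AtomisticToContinuum.Crystallization.Theorems.FrustratedLawDichotomyStrainedPatchCleanCollar (TailPenalty AnnularDefectFloor DefectiveCollarFloor)
open Summit.AtomisticToContinuum.Crystallization.Theorems.FrustratedLawDichotomyStrainedPatchPhaseCut (AnnularPhaseFloor PolyTextureFloor)
open Summit.AtomisticToContinuum.Crystallization.Theorems.FrustratedLawDichotomyStrainedPatchCoreTube (CoreOffTubeFloor)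
open Summit.AtomisticToContinuum.Crystallization.Theorems.FrustratedLawDichotomyStrainedPatchCoreTubeRecord (CoreCoreRelief seam_arith_core
  strainedPatchRec_of_homFloor_of_tailPenalty_of_coreRelief_of_coreOff_of_annularPhase_of_poly_of_annular_of_near)
open Summit.AtomisticToContinuum.Crystallization.Theorems.FrustratedLawDichotomyStrainedPatchHostCells (FamilyCover)
open Summit.AtomisticToContinuum.Crystallization.Theorems.FrustratedLawDichotomyStrainedPatchHomCertTree (CertTree treeOK)
open Summit.AtomisticToContinuum.Crystallization.Theorems.FrustratedLawDichotomyStrainedPatchHomEntryGram (rootC rootW)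
open Summit.AtomisticToContinuum.Crystallization.Theorems.FrustratedLawDichotomyStrainedPatchHomEntryGramHcp (rootCH rootWH)
open Summit.AtomisticToContinuum.Crystallization.Theorems.FrustratedLawDichotomyStrainedPatchHomEntryTable (muRec)
open Summit.AtomisticToContinuum.Crystallization.Theorems.FrustratedLawDichotomyStrainedPatchHomEntryTableP (entryLeafOK6RBKP)
open Summit.AtomisticToContinuum.Crystallization.Theorems.FrustratedLawDichotomyStrainedPatchHomEntryLeafHT (HTCert entryLeafOKHT4UQDCRX
  homFloor_625_of_entryTrees6RBKP_HT4UQDCRX)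
open Summit.AtomisticToContinuum.Crystallization.Theorems.FrustratedLawDichotomyStrainedPatchQuantSlaving (ChartFam HessTab ForceTab SlackTab hessBlk0 force0)
open Summit.AtomisticToContinuum.Crystallization.Theorems.FrustratedLawDichotomyStrainedPatchSVCharge (SlackCert)
open Summit.AtomisticToContinuum.Crystallization.Theorems.FrustratedLawDichotomyStrainedPatchTaylorCharge (HostSep cubicTail)
open Summit.AtomisticToContinuum.Crystallization.Theorems.FrustratedLawDichotomyStrainedPatchBondCalculus (bondD3)
open Summit.AtomisticToContinuum.Crystallization.Theorems.FrustratedLawDichotomyStrainedPatchFarSplit (HostFarTab gammaMaj)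
open Summit.AtomisticToContinuum.Crystallization.Theorems.FrustratedLawDichotomyStrainedPatchTailPacking (TailCert)
open Summit.AtomisticToContinuum.Crystallization.Theorems.FrustratedLawDichotomyAperiodicGapRecordJunction
open Summit.AtomisticToContinuum.Crystallization.Theorems.FrustratedLawDichotomyStrainedPatchRowPrice (addCol)
open Summit.AtomisticToContinuum.Crystallization.Theorems.FrustratedLawDichotomyStrainedPatchGradStep (PairMap PairAdm DiffEvalTab boxTab StageCert
  coreOff_of_envelope_tailCert_pairTabs coreOff_of_envelope_tailCert_oneStage)

/-! ## §1 `StrainedPatchRec` from R1⁗ with certified START and STAGES -/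

/-- ★★★ **R1⁗ in table currency ⟹ StrainedPatchRec**: `HomFloor (1/625) ∧ TailPenalty (24/5) (1/1000) ∧ CoreCoreRelief … (3/5000) ∧ FamilyCover 𝓘 (24/5) (1/100) (1/8) τ ∧
2τ < s₀ ∧ HostSep 𝓘 s₀ ∧ r + 2τ ≤ 7 ∧ HostFarTab 𝓘 τ r Xh ∧ TailCert 𝓘 τ Xe ∧ (Xh + Xe ≤ X) ∧ PairAdm r Pm ∧ DiffEvalTab … (boxTab τ) (P 0)` [START by box evaluation] `∧
(∀ i < n, StageCert … Pm (addCol X (P i)) (P (i+1)))` [every stage by difference / pair tables] `∧ SlackCert … 0 … (addCol X (P n)) ∧ AnnularPhaseFloor ∧ PolyTextureFloor ∧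
AnnularDefectFloor ∧ DefectiveCollarFloor ⟹ StrainedPatchRec`, closed-form tail `cubicTail (s ↦ gammaMaj (s − 2τ))`.
[folklore instantiation: `…CoreTubeRecord.strainedPatchRec_of_homFloor_of_…` with `hC := …GradStep.coreOff_of_envelope_tailCert_pairTabs`] -/
theorem strainedPatchRec_of_homFloor_625_of_envelope_tailCert_pairTabs {𝓘 : ChartFam} {τ s₀ r : ℝ} {X Xh Xe : SlackTab} {Pm : PairMap}
    (P : ℕ → SlackTab) (n : ℕ) (hτ : 0 ≤ τ)
    (hHF : HomFloor (1 / 625)) (hT : TailPenalty (24 / 5) (1 / 1000)) (hRl : CoreCoreRelief (63 / 10) (63 / 10) (24 / 5) (1 / 100) (3 / 5000))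
    (hFC : FamilyCover 𝓘 (24 / 5) (1 / 100) (1 / 8) τ) (hτs : 2 * τ < s₀) (hsep : HostSep 𝓘 s₀) (hr7 : r + 2 * τ ≤ 7)
    (hH : HostFarTab 𝓘 τ r Xh) (hTC : TailCert 𝓘 τ Xe)
    (hdom : ∀ (M₀ : ℕ) (z₀ : Fin M₀ → E3) (c₀ h : Fin M₀), Xh M₀ z₀ c₀ h + Xe M₀ z₀ c₀ h ≤ X M₀ z₀ c₀ h) (hPm : PairAdm r Pm)
    (h0 : DiffEvalTab 𝓘 τ bondD3 (cubicTail fun s => gammaMaj (s - 2 * τ)) r (boxTab τ) (P 0))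
    (hs : ∀ i : ℕ, i < n →
      StageCert 𝓘 τ sigmaOne bondD3 (cubicTail fun s => gammaMaj (s - 2 * τ)) r hessBlk0 force0 Pm (addCol X (P i)) (P (i + 1)))
    (hC : SlackCert 𝓘 τ 0 sigmaOne hessBlk0 force0 (addCol X (P n)))
    (hF : AnnularPhaseFloor (63 / 10) (24 / 5) (63 / 10) (1 / 1000)) (hP : PolyTextureFloor (63 / 10) (24 / 5) (1 / 1000))
    (hA : AnnularDefectFloor (24 / 5) (63 / 10)) (hD : DefectiveCollarFloor (24 / 5)) : StrainedPatchRec :=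
  strainedPatchRec_of_homFloor_of_tailPenalty_of_coreRelief_of_coreOff_of_annularPhase_of_poly_of_annular_of_near (by norm_num) hHF hT hRl
    seam_arith_core (coreOff_of_envelope_tailCert_pairTabs P n hτ hFC hτs hsep hr7 hH hTC hdom hPm h0 hs hC) hF hP le_rfl (by norm_num) (by norm_num)
    hA hD

/-- ★★ **The ONE-STAGE form** (`n = 1`: START `P₀` by box evaluation, ONE stage certificate `addCol X P₀ ↦ P₁`, terminal certificate on `addCol X P₁`) — the shape
the census instruments first (GRAD-76 / GRAD-77). [folklore instantiation: `hC := …GradStep.coreOff_of_envelope_tailCert_oneStage`] -/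
theorem strainedPatchRec_of_homFloor_625_of_envelope_tailCert_oneStage {𝓘 : ChartFam} {τ s₀ r : ℝ} {X Xh Xe : SlackTab} {Pm : PairMap}
    (P₀ P₁ : SlackTab) (hτ : 0 ≤ τ)
    (hHF : HomFloor (1 / 625)) (hT : TailPenalty (24 / 5) (1 / 1000)) (hRl : CoreCoreRelief (63 / 10) (63 / 10) (24 / 5) (1 / 100) (3 / 5000))
    (hFC : FamilyCover 𝓘 (24 / 5) (1 / 100) (1 / 8) τ) (hτs : 2 * τ < s₀) (hsep : HostSep 𝓘 s₀) (hr7 : r + 2 * τ ≤ 7)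
    (hH : HostFarTab 𝓘 τ r Xh) (hTC : TailCert 𝓘 τ Xe)
    (hdom : ∀ (M₀ : ℕ) (z₀ : Fin M₀ → E3) (c₀ h : Fin M₀), Xh M₀ z₀ c₀ h + Xe M₀ z₀ c₀ h ≤ X M₀ z₀ c₀ h) (hPm : PairAdm r Pm)
    (h0 : DiffEvalTab 𝓘 τ bondD3 (cubicTail fun s => gammaMaj (s - 2 * τ)) r (boxTab τ) P₀)
    (h1 : StageCert 𝓘 τ sigmaOne bondD3 (cubicTail fun s => gammaMaj (s - 2 * τ)) r hessBlk0 force0 Pm (addCol X P₀) P₁)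
    (hC : SlackCert 𝓘 τ 0 sigmaOne hessBlk0 force0 (addCol X P₁))
    (hF : AnnularPhaseFloor (63 / 10) (24 / 5) (63 / 10) (1 / 1000)) (hP : PolyTextureFloor (63 / 10) (24 / 5) (1 / 1000))
    (hA : AnnularDefectFloor (24 / 5) (63 / 10)) (hD : DefectiveCollarFloor (24 / 5)) : StrainedPatchRec :=
  strainedPatchRec_of_homFloor_of_tailPenalty_of_coreRelief_of_coreOff_of_annularPhase_of_poly_of_annular_of_near (by norm_num) hHF hT hRl
    seam_arith_core (coreOff_of_envelope_tailCert_oneStage P₀ P₁ hτ hFC hτs hsep hr7 hH hTC hdom hPm h0 h1 hC) hF hP le_rfl (by norm_num) (by norm_num)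
    hA hD

/-! ## §2 ★★★ The crux BY NAME from the entry trees (hcp: the HTU consumer of record) and R1⁗ in table currency -/

/-- ★★★ **27623 FROM THE ENTRY TREES AND R1⁗ WITH CERTIFIED START AND STAGES** — the record junction whose T-side host-step column is in the census's LP
currency: the crux BY NAME from
`UP ∧ 0 ≤ D_X ∧ Eopt-raw ∧ (∃ fcc tree) ∧ (∃ hcp HT4UQDCRX tree) ∧ TailPenalty ∧ CoreCoreRelief ∧ FamilyCover ∧ 2τ < s₀ ∧ HostSep ∧ r + 2τ ≤ 7 ∧ HostFarTab ∧ TailCert ∧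
(Xh + Xe ≤ X) ∧ PairAdm r Pm ∧ DiffEvalTab … (boxTab τ) (P 0) ∧ (∀ i < n, StageCert … (addCol X (P i)) (P (i+1))) ∧ SlackCert at κ = 0 on addCol X (P n) ∧
AnnularPhaseFloor ∧ PolyTextureFloor ∧ AnnularDefectFloor ∧ DefectiveCollarFloor ∧ CC∪T₀ ∧ DD∪T₀`. [folklore instantiation] -/
theorem aperiodicFrustratedLawGap_of_entryTreesU_of_envelope_tailCert_pairTabs {𝓘 : ChartFam} {τ s₀ r : ℝ} {X Xh Xe : SlackTab} {Pm : PairMap}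
    {εE CE DE DX : ℝ} (P : ℕ → SlackTab) (n : ℕ) (hτ : 0 ≤ τ)
    (hε0 : 0 < εE) (hε1 : εE ≤ 1 / 10000) (hU : PeriodicEnergyCeiling (-(7175 / 10000))) (hDX : 0 ≤ DX)
    (hE : SchurElasticPricingX (1 / 20) (1 / 8) w₄₅ ω₄ (3 / 400) (-(7175 / 10000)) (1 / 10000) CE DE DX (LocOptFails eStar εE (3 / 2) 1))
    (Pc : ((Fin 3 × Fin 3) ⊕ Fin 3 → ℤ) → ((Fin 3 × Fin 3) ⊕ Fin 3 → ℤ) → HTCert)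
    (Qf : ((Fin 3 × Fin 3) ⊕ Fin 3 → ℤ) → ((Fin 3 × Fin 3) ⊕ Fin 3 → ℤ) → (Fin 4 → ℤ))
    (T : ((Fin 3 × Fin 3) ⊕ Fin 3 → ℤ) → ((Fin 3 × Fin 3) ⊕ Fin 3 → ℤ) → CertTree ((Fin 3 × Fin 3) ⊕ Fin 3))
    (hFcc : ∃ t : CertTree (Fin 3 × Fin 3), treeOK (entryLeafOK6RBKP muRec) t rootC rootW = true)
    (hHcp : ∃ t : CertTree ((Fin 3 × Fin 3) ⊕ Fin 3), treeOK (entryLeafOKHT4UQDCRX muRec Pc Qf T) t rootCH rootWH = true)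
    (hT : TailPenalty (24 / 5) (1 / 1000)) (hRl : CoreCoreRelief (63 / 10) (63 / 10) (24 / 5) (1 / 100) (3 / 5000))
    (hFC : FamilyCover 𝓘 (24 / 5) (1 / 100) (1 / 8) τ) (hτs : 2 * τ < s₀) (hsep : HostSep 𝓘 s₀) (hr7 : r + 2 * τ ≤ 7)
    (hH : HostFarTab 𝓘 τ r Xh) (hTC : TailCert 𝓘 τ Xe)
    (hdom : ∀ (M₀ : ℕ) (z₀ : Fin M₀ → E3) (c₀ h : Fin M₀), Xh M₀ z₀ c₀ h + Xe M₀ z₀ c₀ h ≤ X M₀ z₀ c₀ h) (hPm : PairAdm r Pm)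
    (h0 : DiffEvalTab 𝓘 τ bondD3 (cubicTail fun s => gammaMaj (s - 2 * τ)) r (boxTab τ) (P 0))
    (hs : ∀ i : ℕ, i < n →
      StageCert 𝓘 τ sigmaOne bondD3 (cubicTail fun s => gammaMaj (s - 2 * τ)) r hessBlk0 force0 Pm (addCol X (P i)) (P (i + 1)))
    (hC : SlackCert 𝓘 τ 0 sigmaOne hessBlk0 force0 (addCol X (P n)))
    (hF : AnnularPhaseFloor (63 / 10) (24 / 5) (63 / 10) (1 / 1000)) (hP : PolyTextureFloor (63 / 10) (24 / 5) (1 / 1000))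
    (hA : AnnularDefectFloor (24 / 5) (63 / 10)) (hD : DefectiveCollarFloor (24 / 5))
    (h2 : CrowdedCoreMotifPricingCapK (1 / 1000) (9 / 5) (133 / 10) (3 / 2) (effPot w₄₅ ω₄ (3 / 400)) (-(7175 / 10000) + 3 / 400)
      (Collar (9 / 2) fun N y j => (∃ s : ℝ, 0 ≤ s ∧ s ≤ 3 / 2 ∧ NonEquilibriumCore (-(7175 / 10000)) 0 7 s (1 / 10000) N y j) ∨
        GoodAtScale (1 / 20) (3 / 2) y j))
    (h3 : DiluteDefectMotifPricingCapK (1 / 1000) (9 / 5) (133 / 10) (3 / 2) (effPot w₄₅ ω₄ (3 / 400)) (-(7175 / 10000) + 3 / 400)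
      (Collar (9 / 2) fun N y j => (∃ s : ℝ, 0 ≤ s ∧ s ≤ 3 / 2 ∧ NonEquilibriumCore (-(7175 / 10000)) 0 7 s (1 / 10000) N y j) ∨
        GoodAtScale (1 / 20) (3 / 2) y j)) :
    Summit.AtomisticToContinuum.Crystallization.Theses.FrustratedLawDichotomy.AperiodicFrustratedLawGap :=
  aperiodicFrustratedLawGap_of_strainedPatchRec hε0 hε1 hU hDX hE
    (strainedPatchRec_of_homFloor_625_of_envelope_tailCert_pairTabs P n hτ (homFloor_625_of_entryTrees6RBKP_HT4UQDCRX Pc Qf T hFcc hHcp) hT hRl hFC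
      hτs hsep hr7 hH hTC hdom hPm h0 hs hC hF hP hA hD) h2 h3

/-- ★★ **Periodic sibling (27624)** of `aperiodicFrustratedLawGap_of_entryTreesU_of_envelope_tailCert_pairTabs`. [folklore instantiation] -/
theorem periodicFrustratedLawGap_of_entryTreesU_of_envelope_tailCert_pairTabs {𝓘 : ChartFam} {τ s₀ r : ℝ} {X Xh Xe : SlackTab} {Pm : PairMap}
    {εE CE DE DX : ℝ} (P : ℕ → SlackTab) (n : ℕ) (hτ : 0 ≤ τ)
    (hε0 : 0 < εE) (hε1 : εE ≤ 1 / 10000) (hU : PeriodicEnergyCeiling (-(7175 / 10000))) (hDX : 0 ≤ DX)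
    (hE : SchurElasticPricingX (1 / 20) (1 / 8) w₄₅ ω₄ (3 / 400) (-(7175 / 10000)) (1 / 10000) CE DE DX (LocOptFails eStar εE (3 / 2) 1))
    (Pc : ((Fin 3 × Fin 3) ⊕ Fin 3 → ℤ) → ((Fin 3 × Fin 3) ⊕ Fin 3 → ℤ) → HTCert)
    (Qf : ((Fin 3 × Fin 3) ⊕ Fin 3 → ℤ) → ((Fin 3 × Fin 3) ⊕ Fin 3 → ℤ) → (Fin 4 → ℤ))
    (T : ((Fin 3 × Fin 3) ⊕ Fin 3 → ℤ) → ((Fin 3 × Fin 3) ⊕ Fin 3 → ℤ) → CertTree ((Fin 3 × Fin 3) ⊕ Fin 3))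
    (hFcc : ∃ t : CertTree (Fin 3 × Fin 3), treeOK (entryLeafOK6RBKP muRec) t rootC rootW = true)
    (hHcp : ∃ t : CertTree ((Fin 3 × Fin 3) ⊕ Fin 3), treeOK (entryLeafOKHT4UQDCRX muRec Pc Qf T) t rootCH rootWH = true)
    (hT : TailPenalty (24 / 5) (1 / 1000)) (hRl : CoreCoreRelief (63 / 10) (63 / 10) (24 / 5) (1 / 100) (3 / 5000))
    (hFC : FamilyCover 𝓘 (24 / 5) (1 / 100) (1 / 8) τ) (hτs : 2 * τ < s₀) (hsep : HostSep 𝓘 s₀) (hr7 : r + 2 * τ ≤ 7)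
    (hH : HostFarTab 𝓘 τ r Xh) (hTC : TailCert 𝓘 τ Xe)
    (hdom : ∀ (M₀ : ℕ) (z₀ : Fin M₀ → E3) (c₀ h : Fin M₀), Xh M₀ z₀ c₀ h + Xe M₀ z₀ c₀ h ≤ X M₀ z₀ c₀ h) (hPm : PairAdm r Pm)
    (h0 : DiffEvalTab 𝓘 τ bondD3 (cubicTail fun s => gammaMaj (s - 2 * τ)) r (boxTab τ) (P 0))
    (hs : ∀ i : ℕ, i < n →
      StageCert 𝓘 τ sigmaOne bondD3 (cubicTail fun s => gammaMaj (s - 2 * τ)) r hessBlk0 force0 Pm (addCol X (P i)) (P (i + 1)))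
    (hC : SlackCert 𝓘 τ 0 sigmaOne hessBlk0 force0 (addCol X (P n)))
    (hF : AnnularPhaseFloor (63 / 10) (24 / 5) (63 / 10) (1 / 1000)) (hP : PolyTextureFloor (63 / 10) (24 / 5) (1 / 1000))
    (hA : AnnularDefectFloor (24 / 5) (63 / 10)) (hD : DefectiveCollarFloor (24 / 5))
    (h2 : CrowdedCoreMotifPricingCapK (1 / 1000) (9 / 5) (133 / 10) (3 / 2) (effPot w₄₅ ω₄ (3 / 400)) (-(7175 / 10000) + 3 / 400)
      (Collar (9 / 2) fun N y j => (∃ s : ℝ, 0 ≤ s ∧ s ≤ 3 / 2 ∧ NonEquilibriumCore (-(7175 / 10000)) 0 7 s (1 / 10000) N y j) ∨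
        GoodAtScale (1 / 20) (3 / 2) y j))
    (h3 : DiluteDefectMotifPricingCapK (1 / 1000) (9 / 5) (133 / 10) (3 / 2) (effPot w₄₅ ω₄ (3 / 400)) (-(7175 / 10000) + 3 / 400)
      (Collar (9 / 2) fun N y j => (∃ s : ℝ, 0 ≤ s ∧ s ≤ 3 / 2 ∧ NonEquilibriumCore (-(7175 / 10000)) 0 7 s (1 / 10000) N y j) ∨
        GoodAtScale (1 / 20) (3 / 2) y j)) :
    Summit.AtomisticToContinuum.Crystallization.Theses.FrustratedLawDichotomy.PeriodicFrustratedLawGap :=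
  periodicFrustratedLawGap_of_strainedPatchRec hε0 hε1 hU hDX hE
    (strainedPatchRec_of_homFloor_625_of_envelope_tailCert_pairTabs P n hτ (homFloor_625_of_entryTrees6RBKP_HT4UQDCRX Pc Qf T hFcc hHcp) hT hRl hFC
      hτs hsep hr7 hH hTC hdom hPm h0 hs hC hF hP hA hD) h2 h3

/-! ## §3 The ONE-STAGE junction (the GRAD-76 / GRAD-77 shape) -/

/-- ★★★ **27623 FROM THE ENTRY TREES AND ONE CERTIFIED LP STAGE** — START `P₀` by box evaluation, ONE stage certificate `addCol X P₀ ↦ P₁` (difference + pair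
tables on the global row polytope + paired evaluation), terminal certificate on `addCol X P₁`, with the cover, host separation, (HFAR), (TAILCERT), the column
domination, an admissible pairing, the E-spine, the collar floors and the caps ⟹ crux. [folklore instantiation] -/
theorem aperiodicFrustratedLawGap_of_entryTreesU_of_envelope_tailCert_oneStage {𝓘 : ChartFam} {τ s₀ r : ℝ} {X Xh Xe : SlackTab} {Pm : PairMap}
    {εE CE DE DX : ℝ} (P₀ P₁ : SlackTab) (hτ : 0 ≤ τ)
    (hε0 : 0 < εE) (hε1 : εE ≤ 1 / 10000) (hU : PeriodicEnergyCeiling (-(7175 / 10000))) (hDX : 0 ≤ DX)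
    (hE : SchurElasticPricingX (1 / 20) (1 / 8) w₄₅ ω₄ (3 / 400) (-(7175 / 10000)) (1 / 10000) CE DE DX (LocOptFails eStar εE (3 / 2) 1))
    (Pc : ((Fin 3 × Fin 3) ⊕ Fin 3 → ℤ) → ((Fin 3 × Fin 3) ⊕ Fin 3 → ℤ) → HTCert)
    (Qf : ((Fin 3 × Fin 3) ⊕ Fin 3 → ℤ) → ((Fin 3 × Fin 3) ⊕ Fin 3 → ℤ) → (Fin 4 → ℤ))
    (T : ((Fin 3 × Fin 3) ⊕ Fin 3 → ℤ) → ((Fin 3 × Fin 3) ⊕ Fin 3 → ℤ) → CertTree ((Fin 3 × Fin 3) ⊕ Fin 3))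
    (hFcc : ∃ t : CertTree (Fin 3 × Fin 3), treeOK (entryLeafOK6RBKP muRec) t rootC rootW = true)
    (hHcp : ∃ t : CertTree ((Fin 3 × Fin 3) ⊕ Fin 3), treeOK (entryLeafOKHT4UQDCRX muRec Pc Qf T) t rootCH rootWH = true)
    (hT : TailPenalty (24 / 5) (1 / 1000)) (hRl : CoreCoreRelief (63 / 10) (63 / 10) (24 / 5) (1 / 100) (3 / 5000))
    (hFC : FamilyCover 𝓘 (24 / 5) (1 / 100) (1 / 8) τ) (hτs : 2 * τ < s₀) (hsep : HostSep 𝓘 s₀) (hr7 : r + 2 * τ ≤ 7)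
    (hH : HostFarTab 𝓘 τ r Xh) (hTC : TailCert 𝓘 τ Xe)
    (hdom : ∀ (M₀ : ℕ) (z₀ : Fin M₀ → E3) (c₀ h : Fin M₀), Xh M₀ z₀ c₀ h + Xe M₀ z₀ c₀ h ≤ X M₀ z₀ c₀ h) (hPm : PairAdm r Pm)
    (h0 : DiffEvalTab 𝓘 τ bondD3 (cubicTail fun s => gammaMaj (s - 2 * τ)) r (boxTab τ) P₀)
    (h1 : StageCert 𝓘 τ sigmaOne bondD3 (cubicTail fun s => gammaMaj (s - 2 * τ)) r hessBlk0 force0 Pm (addCol X P₀) P₁)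
    (hC : SlackCert 𝓘 τ 0 sigmaOne hessBlk0 force0 (addCol X P₁))
    (hF : AnnularPhaseFloor (63 / 10) (24 / 5) (63 / 10) (1 / 1000)) (hP : PolyTextureFloor (63 / 10) (24 / 5) (1 / 1000))
    (hA : AnnularDefectFloor (24 / 5) (63 / 10)) (hD : DefectiveCollarFloor (24 / 5))
    (h2 : CrowdedCoreMotifPricingCapK (1 / 1000) (9 / 5) (133 / 10) (3 / 2) (effPot w₄₅ ω₄ (3 / 400)) (-(7175 / 10000) + 3 / 400)
      (Collar (9 / 2) fun N y j => (∃ s : ℝ, 0 ≤ s ∧ s ≤ 3 / 2 ∧ NonEquilibriumCore (-(7175 / 10000)) 0 7 s (1 / 10000) N y j) ∨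
        GoodAtScale (1 / 20) (3 / 2) y j))
    (h3 : DiluteDefectMotifPricingCapK (1 / 1000) (9 / 5) (133 / 10) (3 / 2) (effPot w₄₅ ω₄ (3 / 400)) (-(7175 / 10000) + 3 / 400)
      (Collar (9 / 2) fun N y j => (∃ s : ℝ, 0 ≤ s ∧ s ≤ 3 / 2 ∧ NonEquilibriumCore (-(7175 / 10000)) 0 7 s (1 / 10000) N y j) ∨
        GoodAtScale (1 / 20) (3 / 2) y j)) :
    Summit.AtomisticToContinuum.Crystallization.Theses.FrustratedLawDichotomy.AperiodicFrustratedLawGap :=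
  aperiodicFrustratedLawGap_of_strainedPatchRec hε0 hε1 hU hDX hE
    (strainedPatchRec_of_homFloor_625_of_envelope_tailCert_oneStage P₀ P₁ hτ (homFloor_625_of_entryTrees6RBKP_HT4UQDCRX Pc Qf T hFcc hHcp) hT hRl hFC
      hτs hsep hr7 hH hTC hdom hPm h0 h1 hC hF hP hA hD) h2 h3

/-- ★★ **Periodic sibling (27624)** of the one-stage junction. [folklore instantiation] -/
theorem periodicFrustratedLawGap_of_entryTreesU_of_envelope_tailCert_oneStage {𝓘 : ChartFam} {τ s₀ r : ℝ} {X Xh Xe : SlackTab} {Pm : PairMap}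
    {εE CE DE DX : ℝ} (P₀ P₁ : SlackTab) (hτ : 0 ≤ τ)
    (hε0 : 0 < εE) (hε1 : εE ≤ 1 / 10000) (hU : PeriodicEnergyCeiling (-(7175 / 10000))) (hDX : 0 ≤ DX)
    (hE : SchurElasticPricingX (1 / 20) (1 / 8) w₄₅ ω₄ (3 / 400) (-(7175 / 10000)) (1 / 10000) CE DE DX (LocOptFails eStar εE (3 / 2) 1))
    (Pc : ((Fin 3 × Fin 3) ⊕ Fin 3 → ℤ) → ((Fin 3 × Fin 3) ⊕ Fin 3 → ℤ) → HTCert)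
    (Qf : ((Fin 3 × Fin 3) ⊕ Fin 3 → ℤ) → ((Fin 3 × Fin 3) ⊕ Fin 3 → ℤ) → (Fin 4 → ℤ))
    (T : ((Fin 3 × Fin 3) ⊕ Fin 3 → ℤ) → ((Fin 3 × Fin 3) ⊕ Fin 3 → ℤ) → CertTree ((Fin 3 × Fin 3) ⊕ Fin 3))
    (hFcc : ∃ t : CertTree (Fin 3 × Fin 3), treeOK (entryLeafOK6RBKP muRec) t rootC rootW = true)
    (hHcp : ∃ t : CertTree ((Fin 3 × Fin 3) ⊕ Fin 3), treeOK (entryLeafOKHT4UQDCRX muRec Pc Qf T) t rootCH rootWH = true)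
    (hT : TailPenalty (24 / 5) (1 / 1000)) (hRl : CoreCoreRelief (63 / 10) (63 / 10) (24 / 5) (1 / 100) (3 / 5000))
    (hFC : FamilyCover 𝓘 (24 / 5) (1 / 100) (1 / 8) τ) (hτs : 2 * τ < s₀) (hsep : HostSep 𝓘 s₀) (hr7 : r + 2 * τ ≤ 7)
    (hH : HostFarTab 𝓘 τ r Xh) (hTC : TailCert 𝓘 τ Xe)
    (hdom : ∀ (M₀ : ℕ) (z₀ : Fin M₀ → E3) (c₀ h : Fin M₀), Xh M₀ z₀ c₀ h + Xe M₀ z₀ c₀ h ≤ X M₀ z₀ c₀ h) (hPm : PairAdm r Pm)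
    (h0 : DiffEvalTab 𝓘 τ bondD3 (cubicTail fun s => gammaMaj (s - 2 * τ)) r (boxTab τ) P₀)
    (h1 : StageCert 𝓘 τ sigmaOne bondD3 (cubicTail fun s => gammaMaj (s - 2 * τ)) r hessBlk0 force0 Pm (addCol X P₀) P₁)
    (hC : SlackCert 𝓘 τ 0 sigmaOne hessBlk0 force0 (addCol X P₁))
    (hF : AnnularPhaseFloor (63 / 10) (24 / 5) (63 / 10) (1 / 1000)) (hP : PolyTextureFloor (63 / 10) (24 / 5) (1 / 1000))
    (hA : AnnularDefectFloor (24 / 5) (63 / 10)) (hD : DefectiveCollarFloor (24 / 5))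
    (h2 : CrowdedCoreMotifPricingCapK (1 / 1000) (9 / 5) (133 / 10) (3 / 2) (effPot w₄₅ ω₄ (3 / 400)) (-(7175 / 10000) + 3 / 400)
      (Collar (9 / 2) fun N y j => (∃ s : ℝ, 0 ≤ s ∧ s ≤ 3 / 2 ∧ NonEquilibriumCore (-(7175 / 10000)) 0 7 s (1 / 10000) N y j) ∨
        GoodAtScale (1 / 20) (3 / 2) y j))
    (h3 : DiluteDefectMotifPricingCapK (1 / 1000) (9 / 5) (133 / 10) (3 / 2) (effPot w₄₅ ω₄ (3 / 400)) (-(7175 / 10000) + 3 / 400)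
      (Collar (9 / 2) fun N y j => (∃ s : ℝ, 0 ≤ s ∧ s ≤ 3 / 2 ∧ NonEquilibriumCore (-(7175 / 10000)) 0 7 s (1 / 10000) N y j) ∨
        GoodAtScale (1 / 20) (3 / 2) y j)) :
    Summit.AtomisticToContinuum.Crystallization.Theses.FrustratedLawDichotomy.PeriodicFrustratedLawGap :=
  periodicFrustratedLawGap_of_strainedPatchRec hε0 hε1 hU hDX hE
    (strainedPatchRec_of_homFloor_625_of_envelope_tailCert_oneStage P₀ P₁ hτ (homFloor_625_of_entryTrees6RBKP_HT4UQDCRX Pc Qf T hFcc hHcp) hT hRl hFC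
      hτs hsep hr7 hH hTC hdom hPm h0 h1 hC hF hP hA hD) h2 h3

/-! ## §4 Sanity: the cell width of record `τ = 1/100`, ONE certified stage -/

/-- At `τ = 1/100` the numeric side conditions of the one-stage junction read `1/50 < s₀` and `r ≤ 349/50`. [formal bookkeeping] -/
example {𝓘 : ChartFam} {s₀ r : ℝ} {X Xh Xe : SlackTab} {Pm : PairMap} {εE CE DE DX : ℝ} (P₀ P₁ : SlackTab)
    (hε0 : 0 < εE) (hε1 : εE ≤ 1 / 10000) (hU : PeriodicEnergyCeiling (-(7175 / 10000))) (hDX : 0 ≤ DX)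
    (hE : SchurElasticPricingX (1 / 20) (1 / 8) w₄₅ ω₄ (3 / 400) (-(7175 / 10000)) (1 / 10000) CE DE DX (LocOptFails eStar εE (3 / 2) 1))
    (Pc : ((Fin 3 × Fin 3) ⊕ Fin 3 → ℤ) → ((Fin 3 × Fin 3) ⊕ Fin 3 → ℤ) → HTCert)
    (Qf : ((Fin 3 × Fin 3) ⊕ Fin 3 → ℤ) → ((Fin 3 × Fin 3) ⊕ Fin 3 → ℤ) → (Fin 4 → ℤ))
    (T : ((Fin 3 × Fin 3) ⊕ Fin 3 → ℤ) → ((Fin 3 × Fin 3) ⊕ Fin 3 → ℤ) → CertTree ((Fin 3 × Fin 3) ⊕ Fin 3))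
    (hFcc : ∃ t : CertTree (Fin 3 × Fin 3), treeOK (entryLeafOK6RBKP muRec) t rootC rootW = true)
    (hHcp : ∃ t : CertTree ((Fin 3 × Fin 3) ⊕ Fin 3), treeOK (entryLeafOKHT4UQDCRX muRec Pc Qf T) t rootCH rootWH = true)
    (hT : TailPenalty (24 / 5) (1 / 1000)) (hRl : CoreCoreRelief (63 / 10) (63 / 10) (24 / 5) (1 / 100) (3 / 5000))
    (hFC : FamilyCover 𝓘 (24 / 5) (1 / 100) (1 / 8) (1 / 100)) (hs₀ : 1 / 50 < s₀) (hsep : HostSep 𝓘 s₀) (hr : r ≤ 349 / 50)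
    (hH : HostFarTab 𝓘 (1 / 100) r Xh) (hTC : TailCert 𝓘 (1 / 100) Xe)
    (hdom : ∀ (M₀ : ℕ) (z₀ : Fin M₀ → E3) (c₀ h : Fin M₀), Xh M₀ z₀ c₀ h + Xe M₀ z₀ c₀ h ≤ X M₀ z₀ c₀ h) (hPm : PairAdm r Pm)
    (h0 : DiffEvalTab 𝓘 (1 / 100) bondD3 (cubicTail fun s => gammaMaj (s - 2 * (1 / 100))) r (boxTab (1 / 100)) P₀)
    (h1 : StageCert 𝓘 (1 / 100) sigmaOne bondD3 (cubicTail fun s => gammaMaj (s - 2 * (1 / 100))) r hessBlk0 force0 Pm (addCol X P₀) P₁)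
    (hC : SlackCert 𝓘 (1 / 100) 0 sigmaOne hessBlk0 force0 (addCol X P₁))
    (hF : AnnularPhaseFloor (63 / 10) (24 / 5) (63 / 10) (1 / 1000)) (hP : PolyTextureFloor (63 / 10) (24 / 5) (1 / 1000))
    (hA : AnnularDefectFloor (24 / 5) (63 / 10)) (hD : DefectiveCollarFloor (24 / 5))
    (h2 : CrowdedCoreMotifPricingCapK (1 / 1000) (9 / 5) (133 / 10) (3 / 2) (effPot w₄₅ ω₄ (3 / 400)) (-(7175 / 10000) + 3 / 400)
      (Collar (9 / 2) fun N y j => (∃ s : ℝ, 0 ≤ s ∧ s ≤ 3 / 2 ∧ NonEquilibriumCore (-(7175 / 10000)) 0 7 s (1 / 10000) N y j) ∨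
        GoodAtScale (1 / 20) (3 / 2) y j))
    (h3 : DiluteDefectMotifPricingCapK (1 / 1000) (9 / 5) (133 / 10) (3 / 2) (effPot w₄₅ ω₄ (3 / 400)) (-(7175 / 10000) + 3 / 400)
      (Collar (9 / 2) fun N y j => (∃ s : ℝ, 0 ≤ s ∧ s ≤ 3 / 2 ∧ NonEquilibriumCore (-(7175 / 10000)) 0 7 s (1 / 10000) N y j) ∨
        GoodAtScale (1 / 20) (3 / 2) y j)) :
    Summit.AtomisticToContinuum.Crystallization.Theses.FrustratedLawDichotomy.AperiodicFrustratedLawGap :=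
  aperiodicFrustratedLawGap_of_entryTreesU_of_envelope_tailCert_oneStage P₀ P₁ (by norm_num) hε0 hε1 hU hDX hE Pc Qf T hFcc hHcp hT hRl hFC
    (by linarith) hsep (by linarith) hH hTC hdom hPm h0 h1 hC hF hP hA hD h2 h3

end Summit.AtomisticToContinuum.Crystallization.Theorems.FrustratedLawDichotomyAperiodicGapRecordJunctionStage

end
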